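import Summits.FinalStateConjecture.FinalStateConjecture.Theorems.BartnikGapSettlingGapExhaustionIKStepNormalisedData
import HarnessLib

/-!
# Crux `GapExhaustion` (stmt-FinalStateConjecture-10808), line `photon-shell-pseudoconvexity`:
# stub (N-6d) `stub_ikKillingBack` — KILLING DATA THROUGH THE AFFINE CHART, in and out

Route `BartnikGapSettling`; helper (`--supports stmt-FinalStateConjecture-10808`) of line lead
c10, third file of the reduction of the outward sweep S5 to IK's local extension theorem. With the
normalised data of file N-6c: a `C^∞` solution `k` of the coordinate Killing equation of `G` on
`ball x ρ ∩ {r < c}` is carried to the solution `kt y = Ls⁻¹ k(x + Ls y)` of the coordinate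
Killing equation of `Gt` on `ball 0 1 ∩ {ft < 0}` (`ikStep_kt_input`), and a solution `Z'` for
`Gt` on `ball 0 δ₁` is carried back to the solution `k' y' = Ls Z'(Ls⁻¹(y' − x))` for `G` on
`ball x (s δ₁ / 6)`, agreeing with `k` below the cylinder where `Z'` agrees with `kt` below
`{ft < 0}` (`stub_ikKillingBack`, registered). Tools: the affine covariance of the coordinate
Killing expression (`affineCov_killingExpr`, p133643) and `fderiv (s⁻² P) = s⁻² fderiv P`.
-/

noncomputable section

set_option maxSynthPendingDepth 3

-- D-0017: single-problem summit, `Summit.<S>.<S>.…` by design (cf. lakefile `weak.linter.dupNamespace`).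
set_option linter.dupNamespace false

namespace Summit.FinalStateConjecture.FinalStateConjecture.Theorems

open Set Function Metric
open Literature.Geometry.Lorentzian Literature.Geometry.Lorentzian.MetricCoord
open scoped Manifold ContDiff Topology ENNReal

section NormalisedData

variable {G : E4 → E4 →L[ℝ] E4 →L[ℝ] ℝ} {W : Set E4} {a c s : ℝ} {x : E4} {L Ls : E4 ≃L[ℝ] E4}
  {Gt : E4 → E4 →L[ℝ] E4 →L[ℝ] ℝ} {ft : E4 → ℝ}

/-- **Killing data in, through the affine chart.** A `C^∞` solution `k` of the coordinate Killing
equation of `G` on `ball x ρ ∩ {r < c}` gives the solution `kt y = Ls⁻¹ k(x + Ls y)` of the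
coordinate Killing equation of `Gt` on `ball 0 1 ∩ {ft < 0}`, provided the affine chart maps the
closed unit ball into `ball x ρ ∩ W`. [folklore] -/
theorem ikStep_kt_input (hGmet : IsMetricOn G W) (hs : 0 < s)
    (hGt : ∀ y : E4, Gt y =
      (s ^ 2)⁻¹ • (G (x + Ls y)).bilinearComp (Ls : E4 →L[ℝ] E4) (Ls : E4 →L[ℝ] E4))
    (hft : ∀ y : E4, ft y = (s ^ 2)⁻¹ * (Kerr.radius a (x + Ls y) - c))
    {ρ : ℝ} {k : E4 → E4}
    (hk : ContDiffOn ℝ ∞ k (ball x ρ ∩ {y | Kerr.radius a y < c}))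
    (hkeq : ∀ y ∈ ball x ρ ∩ {y | Kerr.radius a y < c}, ∀ Y Z : E4,
      fderiv ℝ G y (k y) Y Z + G y (fderiv ℝ k y Y) Z + G y Y (fderiv ℝ k y Z) = 0)
    (htube : ∀ y : E4, ‖y‖ ≤ 1 → x + Ls y ∈ ball x ρ ∧ x + Ls y ∈ W)
    {kt : E4 → E4} (hkt : ∀ y : E4, kt y = (Ls.symm : E4 →L[ℝ] E4) (k (x + Ls y))) :
    ContDiffOn ℝ ∞ kt (ball 0 1 ∩ {y | ft y < 0}) ∧
    ∀ y ∈ ball (0 : E4) 1 ∩ {y | ft y < 0}, ∀ Y Z : E4,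
      fderiv ℝ Gt y (kt y) Y Z + Gt y (fderiv ℝ kt y Y) Z + Gt y Y (fderiv ℝ kt y Z) = 0 := by
  have hs2pos : 0 < (s ^ 2)⁻¹ := by positivity
  have hkt' : kt = fun y => (Ls.symm : E4 →L[ℝ] E4) (k (x + Ls y)) := funext hkt
  set P : E4 → E4 →L[ℝ] E4 →L[ℝ] ℝ :=
    fun y => (G (x + Ls y)).bilinearComp (Ls : E4 →L[ℝ] E4) (Ls : E4 →L[ℝ] E4) with hPdef
  have hGt' : Gt = fun y => (s ^ 2)⁻¹ • P y := funext hGt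
  have hPeq : P = pullMetric G (fun y : E4 => x + Ls y) := affineCov_eq_pullMetric G Ls x
  have hPmet : IsMetricOn P ((fun y : E4 => x + Ls y) ⁻¹' W) := by
    rw [hPeq]; exact hGmet.isMetricOn_pullMetric (affineCov_isCoordChangeOn hGmet Ls x)
  have haff : ContDiff ℝ ∞ (fun y : E4 => x + Ls y) := contDiff_const.add (Ls : E4 →L[ℝ] E4).contDiff
  have hkopen : IsOpen (ball x ρ ∩ {y : E4 | Kerr.radius a y < c}) :=
    isOpen_ball.inter (isOpen_lt (Kerr.continuous_radius a) continuous_const)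
  -- where the affine chart sends `ball 0 1 ∩ {ft < 0}`
  have hmaps : ∀ y ∈ ball (0 : E4) 1 ∩ {y | ft y < 0},
      x + Ls y ∈ ball x ρ ∩ {y : E4 | Kerr.radius a y < c} ∧ x + Ls y ∈ W := by
    rintro y ⟨hy1, hy2⟩
    have hy1' : ‖y‖ ≤ 1 := (mem_ball_zero_iff.1 hy1).le
    obtain ⟨hb, hW'⟩ := htube y hy1'
    have hlt : Kerr.radius a (x + Ls y) < c := by
      have h : (s ^ 2)⁻¹ * (Kerr.radius a (x + Ls y) - c) < 0 := by rw [← hft]; exact hy2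
      have h' : Kerr.radius a (x + Ls y) - c < 0 :=
        ((mul_neg_iff.1 h).resolve_right fun h'' => (not_lt.2 hs2pos.le) h''.1).2
      exact sub_neg.1 h'
    exact ⟨⟨hb, hlt⟩, hW'⟩
  refine ⟨?_, fun y hy Y Z ↦ ?_⟩
  · -- smoothness of `kt`
    have hcomp : ContDiffOn ℝ ∞ (k ∘ fun y : E4 => x + Ls y) (ball 0 1 ∩ {y | ft y < 0}) :=
      hk.comp haff.contDiffOn fun y hy ↦ (hmaps y hy).1
    have h2 := (Ls.symm : E4 →L[ℝ] E4).contDiff.comp_contDiffOn hcomp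
    rw [hkt']
    exact h2.congr fun y _ ↦ rfl
  · -- the Killing equation, read through the affine chart and the rescaling
    obtain ⟨hyk, hyW⟩ := hmaps y hy
    have hGd : DifferentiableAt ℝ G (x + Ls y) :=
      ((hGmet.contDiffOn _ hyW).contDiffAt (hGmet.isOpen.mem_nhds hyW)).differentiableAt (by simp)
    have hkd : DifferentiableAt ℝ k (x + Ls y) :=
      ((hk _ hyk).contDiffAt (hkopen.mem_nhds hyk)).differentiableAt (by simp)
    have hPd : DifferentiableAt ℝ P y :=
      ((hPmet.contDiffOn _ hyW).contDiffAt (hPmet.isOpen.mem_nhds hyW)).differentiableAt (by simp)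
    have hfd : fderiv ℝ Gt y = (s ^ 2)⁻¹ • fderiv ℝ P y := by
      rw [hGt']; exact fderiv_fun_const_smul hPd _
    rw [hfd, hGt y]
    simp only [smul_apply, smul_eq_mul]
    rw [← mul_add, ← mul_add]
    refine mul_eq_zero_of_right _ ?_
    have key := affineCov_killingExpr G k Ls x y Y Z hGd hkd
    rw [hkeq _ hyk] at key
    rw [hkt']
    exact key

end NormalisedData

/-- **Killing data out, through the affine chart** (registered stub N-6d of line lead c10). A
`C^∞` solution `Z'` of the coordinate Killing equation of `Gt` on `ball 0 δ₁` (`δ₁ ≤ 1`) gives the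
solution `k' y' = Ls (Z' (Ls⁻¹ (y' − x)))` of the coordinate Killing equation of `G` on
`ball x (s δ₁ / 6)`; where `Z'` agrees with `kt y = Ls⁻¹ k(x + Ls y)` below `{ft < 0}`, `k'` agrees
with `k` below `{r < c}`. [folklore] -/
theorem stub_ikKillingBack :
    ∀ (G : E4 → E4 →L[ℝ] E4 →L[ℝ] ℝ) (W : Set E4) (a c s : ℝ) (x : E4) (L Ls : E4 ≃L[ℝ] E4)
      (Gt : E4 → E4 →L[ℝ] E4 →L[ℝ] ℝ) (ft : E4 → ℝ) (k kt Z' k' : E4 → E4) (δ₁ : ℝ),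
      IsMetricOn G W → 0 < s →
      (Ls.symm : E4 →L[ℝ] E4) = s⁻¹ • (L.symm : E4 →L[ℝ] E4) → ‖(L.symm : E4 →L[ℝ] E4)‖ ≤ 6 →
      (∀ y : E4, Gt y =
        (s ^ 2)⁻¹ • (G (x + Ls y)).bilinearComp (Ls : E4 →L[ℝ] E4) (Ls : E4 →L[ℝ] E4)) →
      (∀ y : E4, ft y = (s ^ 2)⁻¹ * (Kerr.radius a (x + Ls y) - c)) →
      (∀ y : E4, ‖y‖ ≤ 1 → x + Ls y ∈ W) →
      (∀ y : E4, kt y = (Ls.symm : E4 →L[ℝ] E4) (k (x + Ls y))) → δ₁ ≤ 1 →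
      ContDiffOn ℝ ∞ Z' (ball 0 δ₁) →
      (∀ y ∈ ball (0 : E4) δ₁, ∀ Y W' : E4,
        fderiv ℝ Gt y (Z' y) Y W' + Gt y (fderiv ℝ Z' y Y) W' + Gt y Y (fderiv ℝ Z' y W') = 0) →
      EqOn Z' kt (ball 0 δ₁ ∩ {y | ft y < 0}) →
      (∀ y' : E4, k' y' = Ls (Z' ((Ls.symm : E4 →L[ℝ] E4) (y' - x)))) →
      ContDiffOn ℝ ∞ k' (ball x (s * δ₁ / 6)) ∧
      (∀ y' ∈ ball x (s * δ₁ / 6), ∀ Y' W' : E4,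
        fderiv ℝ G y' (k' y') Y' W' + G y' (fderiv ℝ k' y' Y') W' + G y' Y' (fderiv ℝ k' y' W') = 0) ∧
      EqOn k' k (ball x (s * δ₁ / 6) ∩ {y | Kerr.radius a y < c}) := by
  intro G W a c s x L Ls Gt ft k kt Z' k' δ₁ hGmet hs hLss hLs6 hGt hft htube hkt hδ₁1 hZ'cd hZ'eq hZ'agree hk'
  have hs2pos : 0 < (s ^ 2)⁻¹ := by positivity
  have hs2 : (s ^ 2)⁻¹ ≠ 0 := hs2pos.ne'
  have hk'f : k' = fun y' => Ls (Z' ((Ls.symm : E4 →L[ℝ] E4) (y' - x))) := funext hk'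
  set P : E4 → E4 →L[ℝ] E4 →L[ℝ] ℝ :=
    fun y => (G (x + Ls y)).bilinearComp (Ls : E4 →L[ℝ] E4) (Ls : E4 →L[ℝ] E4) with hPdef
  have hGt' : Gt = fun y => (s ^ 2)⁻¹ • P y := funext hGt
  have hPeq : P = pullMetric G (fun y : E4 => x + Ls y) := affineCov_eq_pullMetric G Ls x
  have hPmet : IsMetricOn P ((fun y : E4 => x + Ls y) ⁻¹' W) := by
    rw [hPeq]; exact hGmet.isMetricOn_pullMetric (affineCov_isCoordChangeOn hGmet Ls x)
  have hnLss : ‖(Ls.symm : E4 →L[ℝ] E4)‖ ≤ 6 / s := by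
    rw [hLss, norm_smul, Real.norm_eq_abs, abs_of_pos (inv_pos.2 hs), div_eq_inv_mul]
    exact mul_le_mul_of_nonneg_left hLs6 (inv_pos.2 hs).le
  -- the inverse affine chart `ψ y' = Ls⁻¹ (y' − x)` on the small ball
  have hψ : ∀ y' ∈ ball x (s * δ₁ / 6),
      (Ls.symm : E4 →L[ℝ] E4) (y' - x) ∈ ball (0 : E4) δ₁ ∧ x + Ls ((Ls.symm : E4 →L[ℝ] E4) (y' - x)) = y' ∧
      ‖(Ls.symm : E4 →L[ℝ] E4) (y' - x)‖ ≤ 1 := by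
    intro y' hy'
    rw [mem_ball, dist_eq_norm] at hy'
    have h1 : ‖(Ls.symm : E4 →L[ℝ] E4) (y' - x)‖ < δ₁ := by
      calc ‖(Ls.symm : E4 →L[ℝ] E4) (y' - x)‖ ≤ ‖(Ls.symm : E4 →L[ℝ] E4)‖ * ‖y' - x‖ :=
            (Ls.symm : E4 →L[ℝ] E4).le_opNorm _
        _ ≤ (6 / s) * ‖y' - x‖ := mul_le_mul_of_nonneg_right hnLss (norm_nonneg _)
        _ < (6 / s) * (s * δ₁ / 6) := mul_lt_mul_of_pos_left hy' (by positivity)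
        _ = δ₁ := by field_simp
    refine ⟨mem_ball_zero_iff.2 h1, ?_, h1.le.trans hδ₁1⟩
    simp
  have hψcd : ContDiff ℝ ∞ (fun y' : E4 => (Ls.symm : E4 →L[ℝ] E4) (y' - x)) :=
    (Ls.symm : E4 →L[ℝ] E4).contDiff.comp (contDiff_id.sub contDiff_const)
  refine ⟨?_, fun y' hy' Y' W' ↦ ?_, fun y' hy' ↦ ?_⟩
  · -- smoothness
    have hcomp : ContDiffOn ℝ ∞ (Z' ∘ fun y' : E4 => (Ls.symm : E4 →L[ℝ] E4) (y' - x)) (ball x (s * δ₁ / 6)) :=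
      hZ'cd.comp hψcd.contDiffOn fun y' hy' ↦ (hψ y' hy').1
    have h2 := (Ls : E4 →L[ℝ] E4).contDiff.comp_contDiffOn hcomp
    rw [hk'f]
    exact h2.congr fun y _ ↦ rfl
  · -- the Killing equation of `G` at `y'`, read at `yt = Ls⁻¹ (y' − x)`
    obtain ⟨hyt, hyx, hyt1⟩ := hψ y' hy'
    set yt : E4 := (Ls.symm : E4 →L[ℝ] E4) (y' - x) with hytdef
    have hyW : x + Ls yt ∈ W := htube yt hyt1
    have hGd : DifferentiableAt ℝ G (x + Ls yt) :=
      ((hGmet.contDiffOn _ hyW).contDiffAt (hGmet.isOpen.mem_nhds hyW)).differentiableAt (by simp)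
    have hk'cd : ContDiffOn ℝ ∞ k' (ball x (s * δ₁ / 6)) := by
      have hcomp : ContDiffOn ℝ ∞ (Z' ∘ fun y' : E4 => (Ls.symm : E4 →L[ℝ] E4) (y' - x))
          (ball x (s * δ₁ / 6)) := hZ'cd.comp hψcd.contDiffOn fun y' hy' ↦ (hψ y' hy').1
      have h2 := (Ls : E4 →L[ℝ] E4).contDiff.comp_contDiffOn hcomp
      rw [hk'f]; exact h2.congr fun y _ ↦ rfl
    have hk'd : DifferentiableAt ℝ k' (x + Ls yt) := by
      rw [hyx]
      exact ((hk'cd _ hy').contDiffAt (isOpen_ball.mem_nhds hy')).differentiableAt (by simp)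
    have key := affineCov_killingExpr G k' Ls x yt ((Ls.symm : E4 →L[ℝ] E4) Y')
      ((Ls.symm : E4 →L[ℝ] E4) W') hGd hk'd
    have hfun : (fun y : E4 => (Ls.symm : E4 →L[ℝ] E4) (k' (x + Ls y))) = Z' := by
      funext y
      rw [hk']
      simp
    have hval : (Ls.symm : E4 →L[ℝ] E4) (k' y') = Z' yt := by
      rw [hk' y']
      simp [hytdef]
    rw [hfun] at key
    simp only [ContinuousLinearEquiv.coe_coe, ContinuousLinearEquiv.apply_symm_apply, hyx] at key
    rw [← key]
    -- `Z'` solves the Killing equation of `P = s² Gt` at `yt`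
    have hPd : DifferentiableAt ℝ P yt :=
      ((hPmet.contDiffOn _ hyW).contDiffAt (hPmet.isOpen.mem_nhds hyW)).differentiableAt (by simp)
    have hZ := hZ'eq yt hyt ((Ls.symm : E4 →L[ℝ] E4) Y') ((Ls.symm : E4 →L[ℝ] E4) W')
    have hfd : fderiv ℝ Gt yt = (s ^ 2)⁻¹ • fderiv ℝ P yt := by
      rw [hGt']; exact fderiv_fun_const_smul hPd _
    rw [hfd, hGt yt] at hZ
    simp only [smul_apply, smul_eq_mul] at hZ
    rw [← mul_add, ← mul_add] at hZ
    have hZ0 := (mul_eq_zero.1 hZ).resolve_left hs2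
    rw [hyx] at hZ0
    have hval' : Ls.symm (k' y') = Z' yt := by simpa only [ContinuousLinearEquiv.coe_coe] using hval
    simp only [ContinuousLinearEquiv.coe_coe] at hZ0 ⊢
    rw [hval']
    exact hZ0
  · -- agreement below the cylinder
    obtain ⟨hy'b, hy'c⟩ := hy'
    obtain ⟨hyt, hyx, _⟩ := hψ y' hy'b
    have hft_neg : ft ((Ls.symm : E4 →L[ℝ] E4) (y' - x)) < 0 := by
      rw [hft, hyx]
      exact mul_neg_of_pos_of_neg hs2pos (sub_neg.2 hy'c)
    have hZ := hZ'agree ⟨hyt, hft_neg⟩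
    rw [hk', hZ, hkt, hyx]
    simp

end Summit.FinalStateConjecture.FinalStateConjecture.Theorems

end
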